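import Mathlib.Algebra.DualNumber
import Mathlib.LinearAlgebra.FiniteDimensional.Lemmas
import Mathlib.LinearAlgebra.Dimension.Constructions
import Mathlib.Data.Matrix.Basis
import Literature.Computability.AlgebraicComplexity.LMR13DualVarieties
import HarnessLib

/-!
# The `𝔤𝔩(W)`-action on forms: tangent map and annihilator (shared core for LMR13 §3.4–§3.5)

Landsberg–Manivel–Ressayre 2013 compute, for a form `P ∈ S^d W^*`, the affine tangent space
`𝔤𝔩(W)·P` of its `GL(W)`-orbit ("`T̂_{[det_n]} PGL(M_n)·[det_n]`", arXiv `p0008.txt:L41`) and the Lie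
algebra of its stabilizer ("we compute the stabilizer of `P_Λ` inside `GL(M_n(ℂ))`", `p0008.txt:L75`;
"it has dimension `2n²`, which is one more than the dimension of the stabilizer of `[det_n]`",
`p0009.txt:L1–3`). This file fixes ONE typed convention for that action, shared by the §3.5 files
(`OrbitClosureDimension.lean`, `LMR13StabilizerDimensions.lean`; cell val-lit, lead-lmr 2026-08-26):

* `glTangentMap P : Matrix σ σ ℂ →ₗ[ℂ] MvPolynomial σ ℂ`, `X ↦ ∑_{a,b} X_{ab} · x_a · ∂_b P`: the matrix
  `X` acts on `ℂ[x_a : a ∈ σ]` as the derivation along the linear vector field `∂x_b = ∑_a X_{ab} x_a`;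
* `glAnn P := ker (glTangentMap P)`, the **annihilator** `𝔤𝔩(W)_P = {X : X·P = 0}` (the Lie algebra
  of the stabilizer of `P`);
* `range_glTangentMap : range (glTangentMap P) = glTangent P` (the span typed as `glTangent` in
  `LMR13DualVarieties.lean`), and rank–nullity
  `finrank_glTangent_add_finrank_glAnn : finrank (glTangent P) + finrank (glAnn P) = (card σ)^2`;
* the first-order Taylor formula through Mathlib's dual numbers (`DualNumber`, `ε² = 0`):
  `snd (aeval (a ↦ x_a + ε v_a) P) = ∑_a v_a ∂_a P` (`snd_aeval_inl_add_inr`), whence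
  `glTangentMap_eq_snd_aeval`: the tool by which group-level identities `P(g_ε · x) = c(ε) P(x)`
  are differentiated in the stabilizer computations of §3.5.

Definitions with bodies and proved API only; no named facts.
[cite: LandsbergManivelRessayre2013, §3.4–§3.5 (pp. 479–481)]
-/

noncomputable section

open MvPolynomial Matrix

namespace Literature.Computability.AlgebraicComplexity

variable {σ : Type*} [Fintype σ]

/-- **The infinitesimal action of `𝔤𝔩(W)` on `S^d W^*`.** The matrix `X ∈ 𝔤𝔩(W) = Matrix σ σ ℂ` acts
on forms `P ∈ ℂ[x_a : a ∈ σ]` as the derivation along the linear vector field `∂x_b = ∑_a X_{ab} x_a`: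
`X · P = ∑_{a,b} X_{ab} x_a ∂_b P`. Its range is the tangent space `𝔤𝔩(W)·P` (`range_glTangentMap`,
LMR 2013 §3.4, arXiv `p0008.txt:L10, L41`), its kernel the annihilator `glAnn P` (§3.5,
`p0008.txt:L75`). [cite: LandsbergManivelRessayre2013, §3.4 (p. 479)] -/
def glTangentMap (P : MvPolynomial σ ℂ) : Matrix σ σ ℂ →ₗ[ℂ] MvPolynomial σ ℂ where
  toFun X := ∑ a, ∑ b, X a b • (MvPolynomial.X a * pderiv b P)
  map_add' X Y := by
    simp only [Matrix.add_apply, add_smul, Finset.sum_add_distrib]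
  map_smul' c X := by
    simp only [Matrix.smul_apply, smul_eq_mul, mul_smul, Finset.smul_sum, RingHom.id_apply]

/-- Unfolding `glTangentMap`: `X · P = ∑_{a,b} X_{ab} x_a ∂_b P`. [cite: LandsbergManivelRessayre2013, §3.4 (p. 479)] -/
theorem glTangentMap_apply (P : MvPolynomial σ ℂ) (X : Matrix σ σ ℂ) :
    glTangentMap P X = ∑ a, ∑ b, X a b • (MvPolynomial.X a * pderiv b P) := rfl

/-- `X · P = ∑_b (∑_a X_{ab} x_a) ∂_b P`: the derivation along the linear vector field of `X`.
[cite: LandsbergManivelRessayre2013, §3.4 (p. 479)] -/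
theorem glTangentMap_eq_sum_mul_pderiv (P : MvPolynomial σ ℂ) (X : Matrix σ σ ℂ) :
    glTangentMap P X = ∑ b, (∑ a, X a b • MvPolynomial.X a) * pderiv b P := by
  rw [glTangentMap_apply, Finset.sum_comm]
  simp only [Finset.sum_mul, smul_mul_assoc]

/-- The elementary matrix `E_{ab}` acts as `x_a ∂_b` (so the `x_a ∂_b P` span the tangent space,
"the span of the forms `X_b · ∂_a f`" as typed in `glTangent`). [cite: LandsbergManivelRessayre2013, §3.4 (p. 479)] -/
theorem glTangentMap_single [DecidableEq σ] (P : MvPolynomial σ ℂ) (a b : σ) :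
    glTangentMap P (Matrix.single a b 1) = MvPolynomial.X a * pderiv b P := by
  rw [glTangentMap_apply, Fintype.sum_eq_single a, Fintype.sum_eq_single b]
  · rw [Matrix.single_apply_same, one_smul]
  · intro b' hb
    rw [Matrix.single_apply_of_col_ne _ _ (Ne.symm hb), zero_smul]
  · intro a' ha
    exact Finset.sum_eq_zero fun b' _ => by
      rw [Matrix.single_apply_of_row_ne (Ne.symm ha), zero_smul]

/-- **`range (glTangentMap P) = glTangent P`**: the typed tangent space `𝔤𝔩(W)·P`
(`LMR13DualVarieties.glTangent`, the span of the `x_b ∂_a P`) is the range of the action map.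
[cite: LandsbergManivelRessayre2013, §3.4 (p. 479)] -/
theorem range_glTangentMap (P : MvPolynomial σ ℂ) :
    LinearMap.range (glTangentMap P) = glTangent P := by
  classical
  apply le_antisymm
  · rintro g ⟨X, rfl⟩
    rw [glTangentMap_apply]
    refine Submodule.sum_mem _ fun a _ => Submodule.sum_mem _ fun b _ => Submodule.smul_mem _ _ ?_
    exact Submodule.subset_span ⟨b, a, rfl⟩
  · rw [glTangent, Submodule.span_le]
    rintro g ⟨a, b, rfl⟩
    exact ⟨Matrix.single b a 1, glTangentMap_single P b a⟩

/-- The tangent space `𝔤𝔩(W)·P` is finite-dimensional (a quotient of `𝔤𝔩(W)`). Stated as a theorem,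
not an instance; use `haveI := glTangent_finiteDimensional P`. [cite: LandsbergManivelRessayre2013, §3.4 (p. 479)] -/
theorem glTangent_finiteDimensional (P : MvPolynomial σ ℂ) : FiniteDimensional ℂ (glTangent P) := by
  rw [← range_glTangentMap]
  infer_instance

/-- **The annihilator `𝔤𝔩(W)_P = {X ∈ 𝔤𝔩(W) : X · P = 0}`** of a form `P`, the Lie algebra of its
stabilizer `GL(W)_P` (LMR 2013 §3.5: "we compute the stabilizer of `P_Λ` inside `GL(M_n(ℂ))` … the
Lie algebra of the stabilizer", arXiv `p0008.txt:L75–80`), typed as the kernel of `glTangentMap P`.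
[cite: LandsbergManivelRessayre2013, §3.5 (p. 481)] -/
def glAnn (P : MvPolynomial σ ℂ) : Submodule ℂ (Matrix σ σ ℂ) :=
  LinearMap.ker (glTangentMap P)

/-- Membership in the annihilator, unfolded: `X ∈ 𝔤𝔩(W)_P ↔ ∑_{a,b} X_{ab} x_a ∂_b P = 0`.
[cite: LandsbergManivelRessayre2013, §3.5 (p. 481)] -/
theorem mem_glAnn_iff (P : MvPolynomial σ ℂ) (X : Matrix σ σ ℂ) :
    X ∈ glAnn P ↔ ∑ a, ∑ b, X a b • (MvPolynomial.X a * pderiv b P) = 0 :=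
  LinearMap.mem_ker

/-- `X ∈ 𝔤𝔩(W)_P ↔ X · P = 0`. [cite: LandsbergManivelRessayre2013, §3.5 (p. 481)] -/
theorem mem_glAnn_iff_glTangentMap_eq_zero (P : MvPolynomial σ ℂ) (X : Matrix σ σ ℂ) :
    X ∈ glAnn P ↔ glTangentMap P X = 0 :=
  LinearMap.mem_ker

/-- **Rank–nullity for the `𝔤𝔩(W)`-action**: `dim 𝔤𝔩(W)·P + dim 𝔤𝔩(W)_P = dim 𝔤𝔩(W) = (dim W)²`
(the count behind "it has dimension `2n²`, which is one more than the dimension of the stabilizer of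
`[det_n]`. This implies … codimension one", arXiv `p0009.txt:L1–4`).
[cite: LandsbergManivelRessayre2013, §3.5 (p. 481)] -/
theorem finrank_glTangent_add_finrank_glAnn (P : MvPolynomial σ ℂ) :
    Module.finrank ℂ (glTangent P) + Module.finrank ℂ (glAnn P) = Fintype.card σ ^ 2 := by
  have h := LinearMap.finrank_range_add_finrank_ker (glTangentMap P)
  rw [range_glTangentMap, Module.finrank_matrix, Module.finrank_self, mul_one, ← sq] at h
  exact h

/-! ## First-order Taylor expansion through dual numbers -/

section Taylor

open TrivSqZeroExt

variable (v : σ → MvPolynomial σ ℂ)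

omit [Fintype σ] in
/-- Zeroth order: substituting `x_a ↦ x_a + ε v_a` (`ε² = 0`) leaves the `ε⁰`-part equal to `P`
(the `O(t⁰)` term of "`(u_t · det_n)(M) = … + O(t²)`", arXiv `p0008.txt:L66`). [cite: LandsbergManivelRessayre2013, §3.5 (p. 481)] -/
theorem fst_aeval_inl_add_inr (P : MvPolynomial σ ℂ) :
    (aeval (fun a => (inl (MvPolynomial.X a) + inr (v a) : DualNumber (MvPolynomial σ ℂ))) P).fst
      = P := by
  induction P using MvPolynomial.induction_on with
  | C c => rw [aeval_C, algebraMap_eq_inl', fst_inl, MvPolynomial.algebraMap_eq]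
  | add p q hp hq => rw [map_add, fst_add, hp, hq]
  | mul_X p i hp => rw [map_mul, aeval_X, fst_mul, hp, fst_add, fst_inl, fst_inr, add_zero]

/-- **First-order Taylor formula** (`ε² = 0`): the `ε¹`-part of `P(x + ε v)` is the derivative of
`P` along the polynomial vector field `v`, `∑_a v_a ∂_a P` (the first-order calculus behind
"`(u_t · det_n)(M) = det_n(A + tS) = n t det_n(A,…,A,S) + O(t²)`", arXiv `p0008.txt:L66`). [cite: LandsbergManivelRessayre2013, §3.5 (p. 481)] -/
theorem snd_aeval_inl_add_inr (P : MvPolynomial σ ℂ) :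
    (aeval (fun a => (inl (MvPolynomial.X a) + inr (v a) : DualNumber (MvPolynomial σ ℂ))) P).snd
      = ∑ a, v a * pderiv a P := by
  classical
  induction P using MvPolynomial.induction_on with
  | C c =>
    rw [aeval_C, algebraMap_eq_inl', snd_inl]
    simp only [pderiv_C, mul_zero, Finset.sum_const_zero]
  | add p q hp hq => rw [map_add, snd_add, hp, hq, ← Finset.sum_add_distrib]; simp only [map_add, mul_add]
  | mul_X p i hp =>
    rw [map_mul, aeval_X, DualNumber.snd_mul, hp, fst_aeval_inl_add_inr, fst_add, fst_inl, fst_inr,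
      add_zero, snd_add, snd_inl, snd_inr, zero_add]
    simp_rw [pderiv_mul, pderiv_X, Pi.single_apply, mul_add, Finset.sum_add_distrib, mul_ite, mul_one,
      mul_zero, Finset.sum_ite_eq, Finset.mem_univ, if_true, Finset.sum_mul, add_comm (p * v i)]
    congr 1
    · exact Finset.sum_congr rfl fun a _ => by ring
    · ring

/-- The action map through dual numbers: `X · P` is the `ε¹`-part of `P` evaluated at
`x_b ↦ x_b + ε ∑_a X_{ab} x_a`, i.e. at `(1 + ε Xᵀ) x`. This is how the identities
`P((1 + εA) M (1 + εB)) = (1 + ε(tr A + tr B)) P(M)` of §3.5 are turned into statements about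
`glAnn P`. [cite: LandsbergManivelRessayre2013, §3.5 (p. 481)] -/
theorem glTangentMap_eq_snd_aeval (P : MvPolynomial σ ℂ) (X : Matrix σ σ ℂ) :
    glTangentMap P X = (aeval (fun b => (inl (MvPolynomial.X b) + inr (∑ a, X a b • MvPolynomial.X a) :
      DualNumber (MvPolynomial σ ℂ))) P).snd := by
  rw [snd_aeval_inl_add_inr, glTangentMap_eq_sum_mul_pderiv]

/-- `X ∈ 𝔤𝔩(W)_P` iff the `ε¹`-part of `P((1 + εXᵀ)x)` vanishes. [cite: LandsbergManivelRessayre2013, §3.5 (p. 481)] -/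
theorem mem_glAnn_iff_snd_aeval_eq_zero (P : MvPolynomial σ ℂ) (X : Matrix σ σ ℂ) :
    X ∈ glAnn P ↔ (aeval (fun b => (inl (MvPolynomial.X b) + inr (∑ a, X a b • MvPolynomial.X a) :
      DualNumber (MvPolynomial σ ℂ))) P).snd = 0 := by
  rw [mem_glAnn_iff_glTangentMap_eq_zero, glTangentMap_eq_snd_aeval]

end Taylor

end Literature.Computability.AlgebraicComplexity

end
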